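import Summits.KontsevichZagierPeriods.KontsevichZagierPeriods.Theorems.UnfoldedStokesStokesGenerationStubSwapTransport
import Summits.KontsevichZagierPeriods.KontsevichZagierPeriods.Theorems.UnfoldedStokesStokesGenerationStubParamDlogCertificate
import Summits.KontsevichZagierPeriods.KontsevichZagierPeriods.Theorems.UnfoldedStokesStokesGenerationStubRungDlogProd
import Summits.KontsevichZagierPeriods.KontsevichZagierPeriods.Theorems.UnfoldedStokesStokesGenerationStubRungClampedAngularCertificateAux
import Summits.KontsevichZagierPeriods.KontsevichZagierPeriods.Theorems.UnfoldedStokesStokesGenerationFibrewiseRungRelations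
import Mathlib.Topology.Algebra.Polynomial

/-!
# `StokesGeneration` (stmt-KontsevichZagierPeriods-3586), line `fibrewise_stokes` — rung 6: the dlog transposition sector

Crux `Summit.KontsevichZagierPeriods.KontsevichZagierPeriods.Theses.UnfoldedStokes.StokesGeneration` (kernel-checked
equivalent to the summit). Line `fibrewise_stokes` reduces it to the residual S2 = `FibrewiseStokesGenerationConjecture`:
every bounded closed-cube representation of value `0` is, after padding and off a null `ℚ`-semialgebraic set, a finite
sum of FIBREWISE STOKES ELEMENTS `D − (G|_{xᵢ=1} − G|_{xᵢ=0})` — in particular WITHOUT the change-of-variables move.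

This file banks the first GENUINELY TWO-DIMENSIONAL sector of S2. Two dlog atoms in different variables with the same
period, `γ(p′(x₀)/p(x₀) − q′(x₁)/q(x₁))` on `[0,1]²` with `p(1)/p(0) = q(1)/q(0)` (`p`, `q` positive polynomials with
real algebraic coefficients, `γ` real algebraic) — for `q = p` this is the COORDINATE TRANSPOSITION `k(x₀) − k(x₁)` of
one atom, a relator of rule (2) that no fibrewise argument in `x₀` or `x₁` alone can see (the fibre periods
`log(p(1)/p(0)) − k̃(x₁)` are transcendental functions) — is an S2-sum on `[0,1]⁴` with seven elements, no kink set,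
no null set, and NO Baker: closed-form transport of `log(p(x₀)/q(x₁))` along the homotopy `1 + y(ρ − 1)`
(`stub_swapTransport`: three elements, directions `y, x₀, x₁`) leaves two boundary loops with CONSTANT fibre periods
`± log(p(1)/p(0))`, which the shared atom `(r − 1)/(1 + y(r − 1))`, `r = p(1)/p(0)`, closes up; each closed loop is
certified by rung 1 with silent parameters (`stub_paramDlogCertificate`, two elements each, directions `y, w`).
Kernel form: `of_mem_relations_dlogSwap` — an unconditional instance of the crux in dimension two.

References: M. Kontsevich, D. Zagier, *Periods* (2001), §1.2 rule (2) and Conjecture 1; J. Ayoub, Ann. of Math. 181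
(2015), Conj. 1.1, Rem. 1.5; J. Fresán, *Une introduction aux périodes* (2024), Rem. 3.7.
-/

noncomputable section

set_option linter.dupNamespace false

namespace Summit.KontsevichZagierPeriods.KontsevichZagierPeriods.Cruxes.StokesGeneration.FibrewiseStokes

open MeasureTheory Set
open Literature.NumberTheory.Transcendental
open Literature.NumberTheory.Transcendental.KZ
open Literature.ModelTheory.ExponentialFields (IsSemialgebraic)

/-! ## Rung 6: the dlog transposition sector (lead c4, wave 2) — assembly -/

/-- **S2 on the dlog transposition sector (rung 6, assembled; lead c4).** For positive polynomials `p`, `q`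
with real algebraic coefficients on `[0,1]` having the SAME logarithmic period, `p(1)/p(0) = q(1)/q(0)`, and `γ` real
algebraic, the closed-square representation with integrand `γ (p′(x₀)/p(x₀) − q′(x₁)/q(x₁))` — two dlog atoms in
DIFFERENT variables, e.g. the coordinate transposition `k(x₀) − k(x₁)` of one atom (`q = p`), a relator of rule (2)
that is genuinely two-dimensional — satisfies the conclusion of `FibrewiseStokesGeneration` with `M′ = 4`, seven
elements, no kink set, no null set, and WITHOUT Baker's theorem: the closed-form transport of `log(p(x₀)/q(x₁))` along
the homotopy `1 + y(ρ − 1)` (`stub_swapTransport`, three elements) leaves two boundary loops whose fibre periods are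
the constants `± log(p(1)/p(0))`, closed up by the atom `(r − 1)/(1 + y(r − 1))`, `r = p(1)/p(0)`, and certified by
rung 1 with silent parameters (`stub_paramDlogCertificate`, twice). [cite: KontsevichZagier2001, §1.2 rule (2)] -/
theorem fibrewiseStokesGeneration_dlogSwap :
    ∀ (γ : ℝ) (p q : Polynomial ℝ), IsAlgebraic ℚ γ → (∀ n, IsAlgebraic ℚ (p.coeff n)) →
      (∀ n, IsAlgebraic ℚ (q.coeff n)) → (∀ u ∈ Set.Icc (0:ℝ) 1, 0 < p.eval u) →
      (∀ u ∈ Set.Icc (0:ℝ) 1, 0 < q.eval u) → p.eval 1 * q.eval 0 = p.eval 0 * q.eval 1 →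
      ∀ (t : IntegralRep 2), t.domain = Set.pi Set.univ (fun _ : Fin 2 => Set.Icc (0:ℝ) 1) →
      (∀ z ∈ Set.pi Set.univ (fun _ : Fin 2 => Set.Icc (0:ℝ) 1), t.integrand z =
        γ * ((Polynomial.derivative p).eval (z 0) / p.eval (z 0) -
          (Polynomial.derivative q).eval (z 1) / q.eval (z 1))) →
    ∃ (M' : ℕ) (hMM' : 2 ≤ M') (J : ℕ) (i : Fin J → Fin M') (G D : Fin J → (Fin M' → ℝ) → ℝ)
      (K : Fin J → Set (Fin M' → ℝ)) (q : Fin J → IntegralRep M') (Z : Set (Fin M' → ℝ)),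
      (∀ j, IsSemialgebraicFunOn ℚ (Set.pi Set.univ (fun _ : Fin M' => Set.Icc (0:ℝ) 1)) (G j) ∧
        IsSemialgebraicFunOn ℚ (Set.pi Set.univ (fun _ : Fin M' => Set.Icc (0:ℝ) 1)) (D j) ∧
        IsSemialgebraic ℚ (K j) ∧
        (∃ B : ℝ, ∀ x ∈ Set.pi Set.univ (fun _ : Fin M' => Set.Icc (0:ℝ) 1), |(G j) x| ≤ B) ∧
        (∀ x ∈ Set.pi Set.univ (fun _ : Fin M' => Set.Icc (0:ℝ) 1), Set.Finite {s : ℝ | Function.update x (i j) s ∈ (K j)}) ∧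
        (∀ x ∈ Set.pi Set.univ (fun _ : Fin M' => Set.Icc (0:ℝ) 1), ContinuousOn (fun s : ℝ => (G j) (Function.update x (i j) s)) (Set.Icc (0:ℝ) 1)) ∧
        (∀ x ∈ Set.pi Set.univ (fun _ : Fin M' => Set.Icc (0:ℝ) 1), x ∉ (K j) → x (i j) ∈ Set.Ioo (0:ℝ) 1 →
          HasDerivAt (fun s : ℝ => (G j) (Function.update x (i j) s)) ((D j) x) (x (i j)))) ∧
      (∀ j, (q j).domain = Set.pi Set.univ (fun _ : Fin M' => Set.Icc (0:ℝ) 1) ∧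
        ∀ x ∈ Set.pi Set.univ (fun _ : Fin M' => Set.Icc (0:ℝ) 1), (q j).integrand x =
          D j x - (G j (Function.update x (i j) 1) - G j (Function.update x (i j) 0))) ∧
      IsSemialgebraic ℚ Z ∧ volume Z = 0 ∧
      ∀ x ∈ Set.pi Set.univ (fun _ : Fin M' => Set.Icc (0:ℝ) 1), x ∉ Z →
        t.integrand (fun l => x (Fin.castLE hMM' l)) = ∑ j, (q j).integrand x := by
  intro γ p q hγ hp hq hppos hqpos hrel t _ hti
  classical
  set S : Set (Fin 4 → ℝ) := Set.pi Set.univ (fun _ : Fin 4 => Set.Icc (0:ℝ) 1) with hS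
  have hSsa : IsSemialgebraic ℚ S := by rw [hS, ← cube_eq_pi]; exact isSemialgebraic_cube
  have h24 : (2 : ℕ) ≤ 4 := by norm_num
  have hmem : ∀ x ∈ S, ∀ i, x i ∈ Set.Icc (0:ℝ) 1 := fun x hx i => hx i (Set.mem_univ _)
  -- constants
  have hp0 : 0 < p.eval 0 := hppos 0 ⟨le_rfl, zero_le_one⟩
  have hp1 : 0 < p.eval 1 := hppos 1 ⟨zero_le_one, le_rfl⟩
  have hq0 : 0 < q.eval 0 := hqpos 0 ⟨le_rfl, zero_le_one⟩
  have hq1 : 0 < q.eval 1 := hqpos 1 ⟨zero_le_one, le_rfl⟩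
  have hp0a : IsAlgebraic ℚ (p.eval 0) := rungClamp_isAlgebraic_eval p hp isAlgebraic_zero
  have hp1a : IsAlgebraic ℚ (p.eval 1) := rungClamp_isAlgebraic_eval p hp isAlgebraic_one
  have hq0a : IsAlgebraic ℚ (q.eval 0) := rungClamp_isAlgebraic_eval q hq isAlgebraic_zero
  have hq1a : IsAlgebraic ℚ (q.eval 1) := rungClamp_isAlgebraic_eval q hq isAlgebraic_one
  -- semialgebraic / continuous atoms on the 4-cube
  have hpx : IsSemialgebraicFunOn ℚ S (fun x => p.eval (x 0)) := isSemialgebraicFunOn_eval_apply hSsa hp 0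
  have hqx : IsSemialgebraicFunOn ℚ S (fun x => q.eval (x 1)) := isSemialgebraicFunOn_eval_apply hSsa hq 1
  have hcst : ∀ {c : ℝ}, IsAlgebraic ℚ c → IsSemialgebraicFunOn ℚ S (fun _ => c) := fun hc =>
    isSemialgebraicFunOn_const_of_isAlgebraic hSsa hc
  have hpxc : ContinuousOn (fun x : Fin 4 → ℝ => p.eval (x 0)) S :=
    (p.continuous.comp (continuous_apply 0)).continuousOn
  have hqxc : ContinuousOn (fun x : Fin 4 → ℝ => q.eval (x 1)) S :=
    (q.continuous.comp (continuous_apply 1)).continuousOn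
  have hpxpos : ∀ x ∈ S, 0 < p.eval (x 0) := fun x hx => hppos _ (hmem x hx 0)
  have hqxpos : ∀ x ∈ S, 0 < q.eval (x 1) := fun x hx => hqpos _ (hmem x hx 1)
  -- the two parametrised loops: numerator / denominator families
  let RA₁ : Fin 1 → (Fin 4 → ℝ) → ℝ := ![fun x => p.eval 1 / q.eval (x 1)]
  let RA₂ : Fin 2 → (Fin 4 → ℝ) → ℝ := ![fun x => p.eval 0 / q.eval (x 1), fun _ => p.eval 1 / p.eval 0]
  let RB₁ : Fin 2 → (Fin 4 → ℝ) → ℝ := ![fun x => p.eval (x 0) / q.eval 1, fun _ => p.eval 1 / p.eval 0]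
  let RB₂ : Fin 1 → (Fin 4 → ℝ) → ℝ := ![fun x => p.eval (x 0) / q.eval 0]
  obtain ⟨GA, DA, rA, hGA, hrA, hidA⟩ := stub_paramDlogCertificate γ 1 2 RA₁ RA₂ hγ
    (Fin.forall_fin_one.2 ((hcst hp1a).div hqx fun x hx => (hqxpos x hx).ne'))
    (Fin.forall_fin_two.2 ⟨(hcst hp0a).div hqx fun x hx => (hqxpos x hx).ne',
      hcst (mem_algebraicClosure_iff.mp (div_mem (mem_algebraicClosure_iff.mpr hp1a)
        (mem_algebraicClosure_iff.mpr hp0a)))⟩)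
    (Fin.forall_fin_one.2 fun x _ s _ => by simp [RA₁])
    (Fin.forall_fin_two.2 ⟨fun x _ s _ => by simp [RA₂],
      fun x _ s _ => by simp [RA₂]⟩)
    (Fin.forall_fin_one.2 fun x hx => div_pos hp1 (hqxpos x hx))
    (Fin.forall_fin_two.2 ⟨fun x hx => div_pos hp0 (hqxpos x hx), fun x _ => div_pos hp1 hp0⟩)
    (Fin.forall_fin_one.2 (continuousOn_const.div hqxc fun x hx => (hqxpos x hx).ne'))
    (Fin.forall_fin_two.2 ⟨continuousOn_const.div hqxc fun x hx => (hqxpos x hx).ne', continuousOn_const⟩)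
    (fun x hx => by
      simp only [RA₁, RA₂, Fin.prod_univ_one, Fin.prod_univ_two, Matrix.cons_val_zero, Matrix.cons_val_one,
        Matrix.cons_val_fin_one]
      field_simp)
  obtain ⟨GB, DB, rB, hGB, hrB, hidB⟩ := stub_paramDlogCertificate γ 2 1 RB₁ RB₂ hγ
    (Fin.forall_fin_two.2 ⟨hpx.div (hcst hq1a) fun x _ => hq1.ne',
      hcst (mem_algebraicClosure_iff.mp (div_mem (mem_algebraicClosure_iff.mpr hp1a)
        (mem_algebraicClosure_iff.mpr hp0a)))⟩)
    (Fin.forall_fin_one.2 (hpx.div (hcst hq0a) fun x _ => hq0.ne'))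
    (Fin.forall_fin_two.2 ⟨fun x _ s _ => by simp [RB₁],
      fun x _ s _ => by simp [RB₁]⟩)
    (Fin.forall_fin_one.2 fun x _ s _ => by simp [RB₂])
    (Fin.forall_fin_two.2 ⟨fun x hx => div_pos (hpxpos x hx) hq1, fun x _ => div_pos hp1 hp0⟩)
    (Fin.forall_fin_one.2 fun x hx => div_pos (hpxpos x hx) hq0)
    (Fin.forall_fin_two.2 ⟨hpxc.div continuousOn_const fun x _ => hq1.ne', continuousOn_const⟩)
    (Fin.forall_fin_one.2 (hpxc.div continuousOn_const fun x _ => hq0.ne'))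
    (fun x hx => by
      simp only [RB₁, RB₂, Fin.prod_univ_one, Fin.prod_univ_two, Matrix.cons_val_zero, Matrix.cons_val_one,
        Matrix.cons_val_fin_one]
      rw [div_mul_div_comm, div_eq_div_iff (mul_ne_zero hq1.ne' hp0.ne') hq0.ne']
      have := hpxpos x hx
      linear_combination p.eval (x 0) * hrel)
  -- the closed-form transport
  obtain ⟨GT, DT, rT, hGT, hrT, hidT⟩ := stub_swapTransport γ p q hγ hp hq hppos hqpos
  -- assembling the seven elements
  let ι := Fin 3 ⊕ (Fin 2 ⊕ Fin 2)
  let e : Fin (3 + (2 + 2)) ≃ ι := finSumFinEquiv.symm.trans (Equiv.sumCongr (Equiv.refl (Fin 3)) finSumFinEquiv.symm)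
  let dirT : Fin 3 → Fin 4 := ![2, 0, 1]
  let dir : ι → Fin 4 := Sum.elim dirT (Sum.elim (fun j => Fin.natAdd 2 j) (fun j => Fin.natAdd 2 j))
  let Gι : ι → (Fin 4 → ℝ) → ℝ := Sum.elim GT (Sum.elim GA GB)
  let Dι : ι → (Fin 4 → ℝ) → ℝ := Sum.elim DT (Sum.elim DA DB)
  let qι : ι → IntegralRep 4 := Sum.elim rT (Sum.elim rA rB)
  have hcond : ∀ s : ι, IsSemialgebraicFunOn ℚ S (Gι s) ∧ IsSemialgebraicFunOn ℚ S (Dι s) ∧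
      IsSemialgebraic ℚ (∅ : Set (Fin 4 → ℝ)) ∧ (∃ B : ℝ, ∀ x ∈ S, |(Gι s) x| ≤ B) ∧
      (∀ x ∈ S, Set.Finite {s' : ℝ | Function.update x (dir s) s' ∈ (∅ : Set (Fin 4 → ℝ))}) ∧
      (∀ x ∈ S, ContinuousOn (fun s' : ℝ => (Gι s) (Function.update x (dir s) s')) (Set.Icc (0:ℝ) 1)) ∧
      (∀ x ∈ S, x ∉ (∅ : Set (Fin 4 → ℝ)) → x (dir s) ∈ Set.Ioo (0:ℝ) 1 →
        HasDerivAt (fun s' : ℝ => (Gι s) (Function.update x (dir s) s')) ((Dι s) x) (x (dir s))) := by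
    have pack : ∀ {Gf Df : (Fin 4 → ℝ) → ℝ} {d : Fin 4},
        (IsSemialgebraicFunOn ℚ S Gf ∧ IsSemialgebraicFunOn ℚ S Df ∧ (∃ B : ℝ, ∀ x ∈ S, |Gf x| ≤ B) ∧
          (∀ x ∈ S, ContinuousOn (fun s' : ℝ => Gf (Function.update x d s')) (Set.Icc (0:ℝ) 1)) ∧
          (∀ x ∈ S, x d ∈ Set.Ioo (0:ℝ) 1 →
            HasDerivAt (fun s' : ℝ => Gf (Function.update x d s')) (Df x) (x d))) →
        IsSemialgebraicFunOn ℚ S Gf ∧ IsSemialgebraicFunOn ℚ S Df ∧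
          IsSemialgebraic ℚ (∅ : Set (Fin 4 → ℝ)) ∧ (∃ B : ℝ, ∀ x ∈ S, |Gf x| ≤ B) ∧
          (∀ x ∈ S, Set.Finite {s' : ℝ | Function.update x d s' ∈ (∅ : Set (Fin 4 → ℝ))}) ∧
          (∀ x ∈ S, ContinuousOn (fun s' : ℝ => Gf (Function.update x d s')) (Set.Icc (0:ℝ) 1)) ∧
          (∀ x ∈ S, x ∉ (∅ : Set (Fin 4 → ℝ)) → x d ∈ Set.Ioo (0:ℝ) 1 →
            HasDerivAt (fun s' : ℝ => Gf (Function.update x d s')) (Df x) (x d)) :=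
      fun ⟨h1, h2, h3, h4, h5⟩ => ⟨h1, h2, Literature.ModelTheory.ExponentialFields.isSemialgebraic_empty, h3,
        fun x _ => by simp, h4, fun x hx _ hxj => h5 x hx hxj⟩
    rintro (j | (j | j))
    · exact pack (hGT j)
    · exact pack (hGA j)
    · exact pack (hGB j)
  have hqc : ∀ s : ι, (qι s).domain = S ∧ ∀ x ∈ S, (qι s).integrand x =
      Dι s x - (Gι s (Function.update x (dir s) 1) - Gι s (Function.update x (dir s) 0)) := by
    rintro (j | (j | j))
    · exact hrT j
    · exact hrA j
    · exact hrB j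
  refine ⟨4, h24, 3 + (2 + 2), fun j => dir (e j), fun j => Gι (e j), fun j => Dι (e j), fun _ => ∅,
    fun j => qι (e j), ∅, fun j => hcond (e j), fun j => hqc (e j),
    Literature.ModelTheory.ExponentialFields.isSemialgebraic_empty, measure_empty, fun x hx _ => ?_⟩
  have hx2 : (fun l : Fin 2 => x (Fin.castLE h24 l)) ∈ Set.pi Set.univ (fun _ : Fin 2 => Set.Icc (0:ℝ) 1) :=
    fun l _ => hx _ (Set.mem_univ _)
  rw [hti _ hx2]
  have hsum : ∑ j : Fin (3 + (2 + 2)), (qι (e j)).integrand x = ∑ s : ι, (qι s).integrand x :=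
    Equiv.sum_comp e (fun s => (qι s).integrand x)
  rw [hsum, Fintype.sum_sum_type, Fintype.sum_sum_type]
  simp only [qι, Sum.elim_inl, Sum.elim_inr]
  rw [hidT x hx, ← hidA x hx, ← hidB x hx]
  simp only [RA₁, RA₂, RB₁, RB₂, Fin.sum_univ_one, Fin.sum_univ_two, Matrix.cons_val_zero, Matrix.cons_val_one,
    Matrix.cons_val_fin_one]
  show γ * ((Polynomial.derivative p).eval (x 0) / p.eval (x 0) -
      (Polynomial.derivative q).eval (x 1) / q.eval (x 1)) = _
  ring

/-- **The crux on the dlog transposition sector (kernel form, dimension two).** The closed-square representation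
with integrand `γ(p′(x₀)/p(x₀) − q′(x₁)/q(x₁))`, `p(1)/p(0) = q(1)/q(0)`, is a Kontsevich–Zagier relation — an
unconditional instance of `StokesGeneration` in dimension `2` (`fibrewiseStokesGeneration_dlogSwap` ∘ the landed
bridge `of_mem_relations_of_fibStokesDecomposition`). [cite: KontsevichZagier2001, §1.2 Conjecture 1] -/
theorem of_mem_relations_dlogSwap (γ : ℝ) (p q : Polynomial ℝ) (hγ : IsAlgebraic ℚ γ)
    (hp : ∀ n, IsAlgebraic ℚ (p.coeff n)) (hq : ∀ n, IsAlgebraic ℚ (q.coeff n))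
    (hppos : ∀ u ∈ Set.Icc (0:ℝ) 1, 0 < p.eval u) (hqpos : ∀ u ∈ Set.Icc (0:ℝ) 1, 0 < q.eval u)
    (hrel : p.eval 1 * q.eval 0 = p.eval 0 * q.eval 1) (t : IntegralRep 2)
    (ht : t.domain = Set.pi Set.univ (fun _ : Fin 2 => Set.Icc (0:ℝ) 1))
    (hti : ∀ z ∈ Set.pi Set.univ (fun _ : Fin 2 => Set.Icc (0:ℝ) 1), t.integrand z =
      γ * ((Polynomial.derivative p).eval (z 0) / p.eval (z 0) -
        (Polynomial.derivative q).eval (z 1) / q.eval (z 1))) : of t ∈ relations :=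
  of_mem_relations_of_fibStokesDecomposition 2 t ht
    (fibrewiseStokesGeneration_dlogSwap γ p q hγ hp hq hppos hqpos hrel t ht hti)

end Summit.KontsevichZagierPeriods.KontsevichZagierPeriods.Cruxes.StokesGeneration.FibrewiseStokes

end
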